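import Literature.AlgebraicGeometry.HodgeTheory.WeilClassesFieldQuaternionMatricesDecomposable
import HarnessLib

/-!
# Moonen–Zarhin's Criterion (2), THE TYPE-2 ROW IN FULL: on `A^{n+1}` with the product polarization, every subfield
# `F ⊆ M_{n+1}(D)` — `D = ℚ(ψ)⟨α, β⟩` ANY quaternion algebra over the real-multiplication field `ℚ(ψ)`, presented by a
# Rosati-symmetric anticommuting pair `α, β` with `α², β² ∈ ℚ(ψ)^×` — has decomposable, hence algebraic, Weil
# classes; by NORMALISING `α^*, β^*` with `a(T)^{-1/2}, b(T)^{-1/2} ∈ ℂ[T]` place by place (Moonen–Zarhin 1998 §1)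

Layer `Literature/AlgebraicGeometry/HodgeTheory`; THEOREMS ONLY — no definition, no named fact, no `sorry` (D-0026, net
debt 0).  Removes the «scalar squares» restriction of the seat's `WeilClassesFieldQuaternionMatricesDecomposable`.

## The print

B. J. J. Moonen, Yu. G. Zarhin, *Weil classes on abelian varieties*, J. reine angew. Math. 496 (1998) 83–92 =
arXiv:alg-geom/9612017 [MoonenZarhin1998WeilClasses] (held text `paper:arxiv-alg-geom_9612017`), §1 Criterion (2)
(chunk p0003 L46–L58) and its proof (L82–L90): for `X ∼ Y^m` with `Y` of TYPE 2 (`End⁰(Y) = D` a quaternion algebra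
over a totally real field `E₀`, `B = M_m(D) = End⁰(X)`, Table 1), EVERY subfield `F ⊆ End⁰(X)` has `W_F` consisting of
decomposable Hodge classes («suppose that `F ⊆ B`, so that `G_div(X) ⊆ Gl_F(V_X)` … `G_div(X)` is connected and
semi-simple, so `G_div(X) ⊆ Sl_F(V_X)`»).  The places (chunk p0002 L104–L118): «`Δ ⊗ ℂ = ∏_{τ ∈ Σ_{E₀}} Δ_ℂ^{(τ)}` …
Type 2: `Δ_ℂ^{(τ)} ≅ M_{2m}(ℂ)` with an orthogonal involution».

## What is proved (on the carrier `H¹(A^{n+1}(ℂ); ℂ)`, `D_X = Σ πᵢ^* h`)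

§0 (private) polynomial / spectral calculus: intertwining, commutation and self-adjointness of `q(T)`; `T P = z P ⟹
q(T) P = q(z) P`; «two operators agreeing on every `P_z` are equal»; `(Σ_w c_w ℓ_w)(z) = c_z`; and **`sq_normaliser`**:
`S² = q(T)`, `[S, T] = 0`, `T` of simple spectrum `s`, `q(z) = c_z² ≠ 0` on `s` ⟹ `(S · Σ_z c_z⁻¹ P_z)² = 1` and
`(Σ_z c_z⁻¹ P_z)(Σ_z c_z P_z) = 1`.
§1 **`weilClassesField_biproduct_le_divisorClassesSpan_of_mem_adjoin_quaternionOver_diagonal`** — for `A` with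
`h ∈ B¹ ⊗ ℂ`, `h^{dim} ≠ 0`, `Q_h` non-degenerate; `ψ^*` `Q_h`-symmetric with `Q(ψ) = 0` (`Q` monic irreducible over
`ℚ`); `α^*, β^*` `Q_h`-symmetric, commuting with `ψ^*`, `α^{*2} = a(ψ^*)`, `β^{*2} = b(ψ^*)` with `a(z) b(z) ≠ 0` at
every complex root `z` of `Q`, `α^*β^* = -β^*α^*`; and `φ ∈ End(A^{n+1})` with `φ^* ∈ ℂ⟨(⊕ψ)^*, (⊕α)^*, (⊕β)^*,
(πₐ ≫ ι_b)^*⟩` (`F ⊆ M_{n+1}(ℚ(ψ)⟨α, β⟩)`), `P(φ) = 0` (`P` monic irreducible, `deg P · 2m = 2(n+1) dim A`):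
`W_F ⊗ ℂ ≤ 𝒟ᵐ ⊗ ℂ`; `…_le_hodgeClassSpan_…`, **`…_le_algebraicClasses_…`**,
`mem_algebraicClasses_of_mem_weilClassesField_biproduct_of_mem_adjoin_quaternionOver_diagonal`.

Scope (honest column).  Type 2 for EVERY quaternion algebra `D` over the totally real centre `E₀ = ℚ(ψ)` (any degree)
given by a Rosati-symmetric anticommuting pair with squares in `E₀^×`, and every power `m = n + 1 ≥ 1`; the
polynomials `a, b` may have complex coefficients (`-- TODO(general form)`: none needed — the print's `a, b ∈ E₀` is
the case of rational coefficients).  Any `A` (no simplicity, no identification `End⁰(A) = D`; for `A` simple of type 2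
with `End⁰(A) = D` this is the print's row up to isogeny — transport: the seat's
`WeilClassesFieldIsogenyTransportOfStructure`).  The existence of such a presentation `α, β` of a given `D` with its
Rosati involution (two orthogonal symmetric pure quaternions) is not formalised here.  No algebraic groups, no
connectedness, no classification.

## References

* [MoonenZarhin1998WeilClasses] B. J. J. Moonen, Yu. G. Zarhin, Weil classes on abelian varieties, J. reine angew.
  Math. 496 (1998) 83–92; arXiv:alg-geom/9612017: §1 Criterion (2) and its proof (chunk p0003 L46–L90), Tables 1–2,
  «Δ ⊗ ℂ = ∏ Δ^{(τ)}» (chunk p0002 L60–L118).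
* [Milne1999LefschetzClasses] J. S. Milne, Lefschetz classes on abelian varieties, Duke Math. J. 96 (1999), §1 p. 643,
  Thm. 3.2, Cor. 4.5.
* [LangeBirkenhake1992] H. Lange, Ch. Birkenhake, Complex Abelian Varieties (1992), §1.1, §5.1, §5.3.
* [McconnellRobson2001] J. C. McConnell, J. C. Robson, Noncommutative Noetherian Rings, GSM 30 (AMS 2001), 3.5.5–3.5.7.
* [HornJohnson2013] R. A. Horn, C. R. Johnson, Matrix Analysis, 2nd ed. (CUP 2013), §1.1 and §1.3 (Lagrange
  interpolation, functional calculus of a diagonalisable operator).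
* [vanGeemen1994HodgeAV] B. van Geemen, LNM 1594 (1994), §2.4.
* [VoisinHodgeI2002] C. Voisin, Hodge Theory and Complex Algebraic Geometry I (CUP 2002), Thm. 11.30.

## Provenance

Lane `lit-hodgefound` (Track 2, Layer A), prover seat `lit-hodgefound-p21` (generation 21), row g21-#5 (after the
append `exists_matrixUnits_of_symmetric_anticommuting_pair` to `WeilClassesFieldDecomposableOfMatrixUnits`).
-/

noncomputable section

open CategoryTheory CategoryTheory.Limits
open Literature.AlgebraicTopology.SingularHomology
open Literature.AlgebraicGeometry.Motives
open Literature.AlgebraicGeometry.VanGeemen1994 (hodgeClassSpan pullbackOne)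
open Literature.AlgebraicGeometry.Milne1999
open Literature.AlgebraicGeometry.Pohlmann1968 (sum_map_π_map_ι map_biproductMap_map_π)
open Literature.Geometry.Kaehler (lefschetzPow)
open Literature.Barriers.HodgeConjecture (divisorClassesSpan)
open Literature.LinearAlgebra
open Polynomial

namespace Literature.AlgebraicGeometry.HodgeTheory

/-! ### §0 (private) polynomial and spectral calculus -/

section Aux

variable {M : Type*} [AddCommGroup M] [Module ℂ M]

/-- `L ∘ q(f) = q(g) ∘ L` when `L ∘ f = g ∘ L`. [folklore] -/
private theorem map_aeval_apply_of_semiconj {N : Type*} [AddCommGroup N] [Module ℂ N] (L : M →ₗ[ℂ] N)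
    (f : Module.End ℂ M) (g : Module.End ℂ N) (hc : ∀ v, L (f v) = g (L v)) (q : ℂ[X]) (v : M) :
    L (aeval f q v) = aeval g q (L v) := by
  induction q using Polynomial.induction_on' generalizing v with
  | add p q hp hq => rw [map_add, map_add, LinearMap.add_apply, LinearMap.add_apply, map_add, hp, hq]
  | monomial k c =>
    rw [aeval_monomial, aeval_monomial, Module.End.mul_apply, Module.End.mul_apply,
      Module.algebraMap_end_apply, Module.algebraMap_end_apply, map_smul]
    congr 1
    induction k generalizing v with
    | zero => rw [pow_zero, pow_zero, Module.End.one_apply, Module.End.one_apply]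
    | succ k ih => rw [pow_succ, pow_succ, Module.End.mul_apply, Module.End.mul_apply, ih, hc]

/-- `q(T)` commutes with `U` when `T` does. [folklore] -/
private theorem aeval_comm_of_comm (T U : Module.End ℂ M) (hc : T * U = U * T) (q : ℂ[X]) :
    aeval T q * U = U * aeval T q := by
  refine LinearMap.ext fun v ↦ ?_
  rw [Module.End.mul_apply, Module.End.mul_apply]
  exact (map_aeval_apply_of_semiconj U T T (fun v ↦ by rw [← Module.End.mul_apply, ← hc, Module.End.mul_apply]) q v).symm

/-- A polynomial in a `B`-self-adjoint operator is `B`-self-adjoint, for any bilinear map `B`. [folklore] -/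
private theorem pairing_aeval_symm {W : Type*} [AddCommGroup W] [Module ℂ W] (B : M →ₗ[ℂ] M →ₗ[ℂ] W)
    (T : Module.End ℂ M) (hT : ∀ v w, B (T v) w = B v (T w)) (q : ℂ[X]) (v w : M) :
    B (aeval T q v) w = B v (aeval T q w) := by
  induction q using Polynomial.induction_on' generalizing v w with
  | add p q hp hq => rw [map_add, LinearMap.add_apply, LinearMap.add_apply, map_add, LinearMap.add_apply, map_add, hp, hq]
  | monomial k c =>
    rw [aeval_monomial, Module.End.mul_apply, Module.End.mul_apply, Module.algebraMap_end_apply,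
      Module.algebraMap_end_apply, map_smul, LinearMap.smul_apply, map_smul]
    congr 1
    induction k generalizing v w with
    | zero => rw [pow_zero, Module.End.one_apply, Module.End.one_apply]
    | succ k ih =>
      conv_lhs => rw [pow_succ', Module.End.mul_apply]
      rw [hT, ih, ← Module.End.mul_apply, ← pow_succ]

/-- Functional calculus on an eigen-idempotent: `T P = z P ⟹ q(T) P = q(z) P`. [folklore] -/
private theorem aeval_mul_eq_eval_smul {T P : Module.End ℂ M} {z : ℂ} (hTP : T * P = z • P) (q : ℂ[X]) :
    aeval T q * P = q.eval z • P := by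
  induction q using Polynomial.induction_on' with
  | add p q hp hq => rw [map_add, add_mul, hp, hq, eval_add, add_smul]
  | monomial k c =>
    have hk : ∀ k : ℕ, T ^ k * P = z ^ k • P := by
      intro k
      induction k with
      | zero => rw [pow_zero, pow_zero, one_mul, one_smul]
      | succ k ih => rw [pow_succ, mul_assoc, hTP, mul_smul_comm, ih, smul_smul, pow_succ, mul_comm z]
    rw [aeval_monomial, eval_monomial, mul_assoc, hk, Algebra.algebraMap_eq_smul_one, smul_mul_assoc, one_mul,
      smul_smul]

/-- If `Σ_z P_z = 1`, two operators agreeing on every `P_z` are equal. [folklore] -/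
private theorem eq_of_forall_mul_proj_eq {κ : Type*} {s : Finset κ} {P : κ → Module.End ℂ M}
    (hPsum : ∑ z ∈ s, P z = 1) {L L' : Module.End ℂ M} (hL : ∀ z ∈ s, L * P z = L' * P z) : L = L' := by
  rw [← mul_one L, ← hPsum, Finset.mul_sum, ← mul_one L', ← hPsum, Finset.mul_sum]
  exact Finset.sum_congr rfl hL

/-- `(Σ_w c_w ℓ_w)(z) = c_z` for the Lagrange basis `ℓ_w` of a finite `s ∋ z`. [folklore] -/
private theorem eval_sum_C_mul_basis {s : Finset ℂ} (c : ℂ → ℂ) {z : ℂ} (hz : z ∈ s) :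
    (∑ w ∈ s, C (c w) * Lagrange.basis s id w).eval z = c z := by
  classical
  rw [Polynomial.eval_finsetSum, Finset.sum_eq_single_of_mem z hz fun w _ hwz ↦ ?_]
  · have h1 : (Lagrange.basis s id z).eval z = 1 := Lagrange.eval_basis_self (v := id) (Set.injOn_id _) hz
    rw [eval_mul, eval_C, h1, mul_one]
  · have h0 : (Lagrange.basis s id w).eval z = 0 := Lagrange.eval_basis_of_ne (v := id) hwz hz
    rw [eval_mul, eval_C, h0, mul_zero]

/-- **The normalisation.** If `S² = q(T)`, `S` commutes with `T`, `T` has simple spectrum `s` and `q(z) = c_z² ≠ 0` on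
`s`, then `R = Σ_z c_z⁻¹ P_z ∈ ℂ[T]` satisfies `(S R)² = 1` and `R · (Σ_z c_z P_z) = 1`. [folklore] -/
private theorem sq_normaliser {T S : Module.End ℂ M} {s : Finset ℂ} (hs : s.Nonempty)
    (hTs : aeval T (Lagrange.nodal s id) = 0) {q : ℂ[X]} (hS2 : S * S = aeval T q) (hTS : T * S = S * T)
    {c : ℂ → ℂ} (hc : ∀ z ∈ s, q.eval z = c z * c z) (hc0 : ∀ z ∈ s, c z ≠ 0) :
    S * aeval T (∑ w ∈ s, C ((c w)⁻¹) * Lagrange.basis s id w) *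
        (S * aeval T (∑ w ∈ s, C ((c w)⁻¹) * Lagrange.basis s id w)) = 1 ∧
      aeval T (∑ w ∈ s, C ((c w)⁻¹) * Lagrange.basis s id w) * aeval T (∑ w ∈ s, C (c w) * Lagrange.basis s id w) = 1 := by
  classical
  obtain ⟨hPsum, -, -, hTP⟩ := aeval_lagrange_basis_spectral T s hs hTs
  set R := aeval T (∑ w ∈ s, C ((c w)⁻¹) * Lagrange.basis s id w) with hRdef
  set R' := aeval T (∑ w ∈ s, C (c w) * Lagrange.basis s id w) with hR'def
  have hRP : ∀ z ∈ s, R * aeval T (Lagrange.basis s id z) = (c z)⁻¹ • aeval T (Lagrange.basis s id z) :=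
    fun z hz ↦ by rw [hRdef, aeval_mul_eq_eval_smul (hTP z hz), eval_sum_C_mul_basis (fun w ↦ (c w)⁻¹) hz]
  have hR'P : ∀ z ∈ s, R' * aeval T (Lagrange.basis s id z) = c z • aeval T (Lagrange.basis s id z) :=
    fun z hz ↦ by rw [hR'def, aeval_mul_eq_eval_smul (hTP z hz), eval_sum_C_mul_basis c hz]
  have hRS : R * S = S * R := aeval_comm_of_comm T S hTS _
  refine ⟨?_, ?_⟩
  · have hSS : S * R * (S * R) = aeval T q * (R * R) := by
      rw [mul_assoc, ← mul_assoc R S, hRS, mul_assoc, ← mul_assoc S S, hS2]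
    refine eq_of_forall_mul_proj_eq hPsum fun z hz ↦ ?_
    rw [hSS, one_mul, mul_assoc, mul_assoc, hRP z hz, mul_smul_comm, hRP z hz, smul_smul, mul_smul_comm,
      aeval_mul_eq_eval_smul (hTP z hz), smul_smul, hc z hz,
      show (c z)⁻¹ * (c z)⁻¹ * (c z * c z) = 1 by field_simp [hc0 z hz], one_smul]
  · refine eq_of_forall_mul_proj_eq hPsum fun z hz ↦ ?_
    rw [one_mul, mul_assoc, hR'P z hz, mul_smul_comm, hRP z hz, smul_smul, mul_inv_cancel₀ (hc0 z hz), one_smul]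

end Aux

/-- The complex roots of a monic integer polynomial irreducible over `ℚ` are simple and non-empty, with nodal
polynomial the polynomial itself. [folklore] -/
private theorem nodal_roots_toFinset {Q : Polynomial ℤ} (hQm : Q.Monic)
    (hQirr : Irreducible (Q.map (Int.castRingHom ℚ))) :
    Lagrange.nodal (Q.map (Int.castRingHom ℂ)).roots.toFinset id = Q.map (Int.castRingHom ℂ) ∧
      (Q.map (Int.castRingHom ℂ)).roots.toFinset.Nonempty := by
  classical
  have hQc : Q.map (Int.castRingHom ℂ) = (Q.map (Int.castRingHom ℚ)).map (algebraMap ℚ ℂ) := by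
    rw [Polynomial.map_map, RingHom.ext_int ((algebraMap ℚ ℂ).comp (Int.castRingHom ℚ)) (Int.castRingHom ℂ)]
  have hsep : (Q.map (Int.castRingHom ℂ)).Separable := by
    rw [hQc]
    exact hQirr.separable.map
  have hmon : (Q.map (Int.castRingHom ℂ)).Monic := hQm.map _
  have hnodup : (Q.map (Int.castRingHom ℂ)).roots.Nodup := Polynomial.nodup_roots hsep
  refine ⟨?_, ?_⟩
  · have hsplit := (IsAlgClosed.splits (Q.map (Int.castRingHom ℂ))).eq_prod_roots_of_monic hmon
    rw [Lagrange.nodal_eq, ← Multiset.toFinset_eq hnodup, Finset.prod_mk]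
    exact hsplit.symm
  · have hdeg : (Q.map (Int.castRingHom ℂ)).degree ≠ 0 := by
      have h1 : 0 < (Q.map (Int.castRingHom ℚ)).natDegree :=
        Polynomial.natDegree_pos_iff_degree_pos.2 (Polynomial.degree_pos_of_irreducible hQirr)
      rw [hQm.natDegree_map] at h1
      intro h0
      rw [Polynomial.degree_eq_natDegree hmon.ne_zero, hQm.natDegree_map] at h0
      exact h1.ne' (by exact_mod_cast h0)
    obtain ⟨z, hz⟩ := IsAlgClosed.exists_root _ hdeg
    exact ⟨z, Multiset.mem_toFinset.2 ((Polynomial.mem_roots hmon.ne_zero).2 hz)⟩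

/-! ### §1 THE TYPE-2 ROW IN FULL: a quaternion algebra over the real-multiplication centre -/

section QuaternionOverRealField

variable {A : AbelianVariety ℂ} {h : complexBetti A.X 2} {n : ℕ} {ψ α β : A ⟶ A} {qa qb : ℂ[X]}
  {φ : ⨁ (fun _ : Fin (n + 1) => A) ⟶ ⨁ (fun _ : Fin (n + 1) => A)} {P Q : Polynomial ℤ} {e m : ℕ}

/-- **THE TYPE-2 ROW IN FULL — `W_F(A^{n+1})` IS DECOMPOSABLE FOR EVERY SUBFIELD `F ⊆ M_{n+1}(D)`, `D = ℚ(ψ)⟨α, β⟩` A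
QUATERNION ALGEBRA OVER THE REAL-MULTIPLICATION FIELD `E₀ = ℚ(ψ)`.** Let `A` be a complex abelian variety of positive
dimension with `h ∈ B¹(A) ⊗ ℂ`, `h^{dim A} ≠ 0`, `Q_h` non-degenerate; `ψ ∈ End(A)` ROSATI-SYMMETRIC with `Q(ψ) = 0`,
`Q ∈ ℤ[T]` monic irreducible over `ℚ` (the totally real centre `E₀ = ℚ(ψ)`, of any degree); `α, β ∈ End(A)`
Rosati-symmetric, commuting with `ψ^*`, ANTICOMMUTING, with `α^{*2} = a(ψ^*)`, `β^{*2} = b(ψ^*)` for polynomials `a, b`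
NOT VANISHING AT ANY COMPLEX ROOT OF `Q` — i.e. `α² = a(ψ)`, `β² = b(ψ)` are UNITS of `E₀` (every quaternion algebra
over `E₀` with its type-2 positive involution is so presented: two orthogonal symmetric pure quaternions); let
`X = A^{n+1}` carry the product polarization `D_X = Σ πᵢ^* h`, and let `φ ∈ End(X)` have `φ^*` in the complex algebra
generated by the diagonals `(⊕ψ)^*, (⊕α)^*, (⊕β)^*` and the matrix units `(πₐ ≫ ι_b)^*` — `F = ℚ(φ) ⊆ M_{n+1}(D) ⊆
End⁰(X)` — with `P(φ) = 0`, `P ∈ ℤ[T]` monic irreducible of degree `e`, `e · 2m = 2(n+1) dim A`. Then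
`W_F ⊗ ℂ ≤ 𝒟ᵐ ⊗ ℂ`: ALL WEIL CLASSES OF `F` ARE DECOMPOSABLE. Proof — THE NORMALISATION: with `T = (⊕ψ)^*` (simple
spectrum `s` = the roots of `Q`, Lagrange projectors `P_z`) and square roots `σ_z² = a(z)`, `τ_z² = b(z)`, the operators
`R_a = Σ_z σ_z⁻¹ P_z`, `R_b = Σ_z τ_z⁻¹ P_z ∈ ℂ[T]` give `S = (⊕α)^* R_a`, `T′ = (⊕β)^* R_b` with `S² = T′² = 1`,
`S T′ = -T′ S`, both Rosati-symmetric and in `B ⊗ ℂ` (§0 `sq_normaliser`: «`Δ ⊗ ℂ = ∏_τ Δ_ℂ^{(τ)}`, `Δ_ℂ^{(τ)} ≅ M₂(ℂ)`»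
place by place); their `2 × 2` block `(x′, y′, p′)` (`exists_matrixUnits_of_symmetric_anticommuting_pair`) lies in
`ℂ⟨S, T′⟩`, hence commutes with the units `e_{ab}` and with `T`; the Morita datum `x_{(i,c)} = e_{i0} x′_c`,
`y_{(i,c)} = y′_c e_{0i}`, `p = e_{00} p′` over `Fin (n+1) × Fin 2` is `Q_{D_X}`-orthogonal inside `B ⊗ ℂ`, commutes with
`T`, and its span together with `ℂ[T]` contains `(⊕α)^* = S · Σ_z σ_z P_z`, `(⊕β)^*` and every `e_{ab}`; then
`weilClassesField_le_divisorClassesSpan_of_moritaData_of_symmetric`. This is the print's row «`Y` of Type 2,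
`F ⊆ B = M_m(D) = End⁰(X)`: decomposable» with centre of ANY degree, ANY quaternion algebra `D` over it and ANY
`m = n + 1 ≥ 1`, on the carrier, with no algebraic groups. [cite: MoonenZarhin1998WeilClasses, §1 Criterion (2) and its proof, types 1–2 (chunk p0003 L46–L90); Tables 1–2 and «Δ ⊗ ℂ = ∏_τ Δ_ℂ^{(τ)}» (chunk p0002 L60–L118)]
[cite: Milne1999LefschetzClasses, §1 p. 643, Thm. 3.2, Cor. 4.5] [cite: McconnellRobson2001, 3.5.5–3.5.7] [cite: HornJohnson2013, §1.1 and §1.3] -/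
theorem weilClassesField_biproduct_le_divisorClassesSpan_of_mem_adjoin_quaternionOver_diagonal (hA : 0 < A.dim)
    (hh : h ∈ hodgeClassSpan A.dim A.X 1) (htop : lefschetzPow h (A.dim - 1) 2 h ≠ 0)
    (hnd : ∀ x : complexBetti A.X 1, (∀ y, polarizationPairingOne A.X h (A.dim - 1) x y = 0) → x = 0)
    (hψsym : ∀ v w : complexBetti A.X 1, polarizationPairingOne A.X h (A.dim - 1) (pullbackOne A ψ v) w =
      polarizationPairingOne A.X h (A.dim - 1) v (pullbackOne A ψ w))
    (hQm : Q.Monic) (hQirr : Irreducible (Q.map (Int.castRingHom ℚ)))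
    (hψQ : Polynomial.eval₂ (Int.castRingHom (CategoryTheory.End A)) (ψ : CategoryTheory.End A) Q = 0)
    (hα2 : pullbackOne A α * pullbackOne A α = aeval (pullbackOne A ψ) qa)
    (hqa : ∀ z : ℂ, (Q.map (Int.castRingHom ℂ)).IsRoot z → qa.eval z ≠ 0)
    (hβ2 : pullbackOne A β * pullbackOne A β = aeval (pullbackOne A ψ) qb)
    (hqb : ∀ z : ℂ, (Q.map (Int.castRingHom ℂ)).IsRoot z → qb.eval z ≠ 0)
    (hanti : pullbackOne A α * pullbackOne A β = -(pullbackOne A β * pullbackOne A α))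
    (hαsym : ∀ v w : complexBetti A.X 1, polarizationPairingOne A.X h (A.dim - 1) (pullbackOne A α v) w =
      polarizationPairingOne A.X h (A.dim - 1) v (pullbackOne A α w))
    (hβsym : ∀ v w : complexBetti A.X 1, polarizationPairingOne A.X h (A.dim - 1) (pullbackOne A β v) w =
      polarizationPairingOne A.X h (A.dim - 1) v (pullbackOne A β w))
    (hψα : pullbackOne A ψ * pullbackOne A α = pullbackOne A α * pullbackOne A ψ)
    (hψβ : pullbackOne A ψ * pullbackOne A β = pullbackOne A β * pullbackOne A ψ)
    (hPm : P.Monic) (hPe : P.natDegree = e) (hPirr : Irreducible (P.map (Int.castRingHom ℚ)))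
    (hφ : Polynomial.eval₂ (Int.castRingHom (CategoryTheory.End (⨁ (fun _ : Fin (n + 1) => A))))
      (φ : CategoryTheory.End (⨁ (fun _ : Fin (n + 1) => A))) P = 0)
    (her : e * (2 * m) = 2 * ((n + 1) * A.dim))
    (hF : pullbackOne (⨁ (fun _ : Fin (n + 1) => A)) φ ∈ Algebra.adjoin ℂ
      (insert (pullbackOne (⨁ (fun _ : Fin (n + 1) => A)) (biproduct.map fun _ : Fin (n + 1) => ψ))
        (insert (pullbackOne (⨁ (fun _ : Fin (n + 1) => A)) (biproduct.map fun _ : Fin (n + 1) => α))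
          (insert (pullbackOne (⨁ (fun _ : Fin (n + 1) => A)) (biproduct.map fun _ : Fin (n + 1) => β))
            (Set.range fun ab : Fin (n + 1) × Fin (n + 1) ↦ pullbackOne (⨁ (fun _ : Fin (n + 1) => A))
              (biproduct.π (fun _ : Fin (n + 1) => A) ab.1 ≫ biproduct.ι (fun _ : Fin (n + 1) => A) ab.2)))))) :
    weilClassesField (⨁ (fun _ : Fin (n + 1) => A)) φ P (2 * m) ≤
      divisorClassesSpan (⨁ (fun _ : Fin (n + 1) => A)).X (⨁ (fun _ : Fin (n + 1) => A)).dim m := by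
  classical
  obtain ⟨hhX, -, hndX⟩ := sumPolarizationClass_hypotheses (fun _ : Fin (n + 1) => A) (fun _ => h)
      (fun _ => hA) (fun _ => hh) (fun _ => htop) (fun _ => hnd)
  have herX : e * (2 * m) = 2 * (⨁ (fun _ : Fin (n + 1) => A)).dim := by rw [dim_biproduct_const_succ A n, her]
  -- notation
  set X := ⨁ (fun _ : Fin (n + 1) => A) with hXdef
  set D := sumPolarizationClass (fun _ : Fin (n + 1) => A) (fun _ => h) with hDdef
  set T : Module.End ℂ (complexBetti X.X 1) := pullbackOne X (biproduct.map fun _ : Fin (n + 1) => ψ) with hTdef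
  set Sa : Module.End ℂ (complexBetti X.X 1) := pullbackOne X (biproduct.map fun _ : Fin (n + 1) => α) with hSadef
  set Sb : Module.End ℂ (complexBetti X.X 1) := pullbackOne X (biproduct.map fun _ : Fin (n + 1) => β) with hSbdef
  set U : Fin (n + 1) → Fin (n + 1) → Module.End ℂ (complexBetti X.X 1) := fun a b ↦
    pullbackOne X (biproduct.π (fun _ : Fin (n + 1) => A) a ≫ biproduct.ι (fun _ : Fin (n + 1) => A) b) with hUdef
  have hU : ∀ a b c d, U a b * U c d = if b = c then U a d else 0 := fun a b c d ↦ pullbackOne_π_comp_ι_mul a b c d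
  have hUsum : ∑ a, U a a = 1 := sum_pullbackOne_π_comp_ι
  have hUadj : ∀ a b (v w : complexBetti X.X 1), polarizationPairingOne X.X D (X.dim - 1) (U a b v) w =
      polarizationPairingOne X.X D (X.dim - 1) v (U b a w) :=
    fun a b v w ↦ polarizationPairingOne_pullbackOne_π_comp_ι hA hh htop hnd a b v w
  have hUadjoin : ∀ a b, U a b ∈ Algebra.adjoin ℂ (symmetricPullbackSpan X D : Set (Module.End ℂ (complexBetti X.X 1))) :=
    fun a b ↦ pullbackOne_π_comp_ι_mem_adjoin_symmetricPullbackSpan hA hh htop hnd a b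
  -- the diagonals
  have hT_symm : T ∈ symmetricPullbackSpan X D :=
    pullbackOne_biproductMap_mem_symmetricPullbackSpan (fun _ : Fin (n + 1) => A) (fun _ => h) (fun _ => hA)
      (fun _ => ψ) (fun _ => hψsym)
  have hSa_full : Sa ∈ symmetricPullbackSpan X D :=
    pullbackOne_biproductMap_mem_symmetricPullbackSpan (fun _ : Fin (n + 1) => A) (fun _ => h) (fun _ => hA)
      (fun _ => α) (fun _ => hαsym)
  have hSb_full : Sb ∈ symmetricPullbackSpan X D :=
    pullbackOne_biproductMap_mem_symmetricPullbackSpan (fun _ : Fin (n + 1) => A) (fun _ => h) (fun _ => hA)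
      (fun _ => β) (fun _ => hβsym)
  have hSanti : Sa * Sb = -(Sb * Sa) := pullbackOne_biproductMap_const_mul_eq_neg hanti
  have hTSa : T * Sa = Sa * T := pullbackOne_biproductMap_const_comm hψα
  have hTSb : T * Sb = Sb * T := pullbackOne_biproductMap_const_comm hψβ
  have hTU : ∀ c d, T * U c d = U c d * T := fun c d ↦ pullbackOne_biproductMap_const_mul_π_comp_ι ψ c d
  have hSaU : ∀ c d, Sa * U c d = U c d * Sa := fun c d ↦ pullbackOne_biproductMap_const_mul_π_comp_ι α c d
  have hSbU : ∀ c d, Sb * U c d = U c d * Sb := fun c d ↦ pullbackOne_biproductMap_const_mul_π_comp_ι β c d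
  -- the square relations `(⊕γ)^{*2} = q((⊕ψ)^*)` transfer slotwise
  have hsq : ∀ {γ : A ⟶ A} {q : ℂ[X]}, pullbackOne A γ * pullbackOne A γ = aeval (pullbackOne A ψ) q →
      pullbackOne X (biproduct.map fun _ : Fin (n + 1) => γ) * pullbackOne X (biproduct.map fun _ : Fin (n + 1) => γ) =
        aeval T q := by
    intro γ q hγ
    refine LinearMap.ext fun v ↦ ?_
    rw [pullbackOne_biproductMap_const_mul_apply, hγ]
    conv_rhs => rw [← sum_map_π_map_ι (fun _ : Fin (n + 1) => A) v, map_sum]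
    refine Finset.sum_congr rfl fun c _ ↦ ?_
    exact (map_aeval_apply_of_semiconj (complexBetti.map (biproduct.π (fun _ : Fin (n + 1) => A) c).hom.hom.hom 1).hom
      (pullbackOne A ψ) T (fun w ↦ (map_biproductMap_map_π (fun _ : Fin (n + 1) => A) (fun _ => ψ) c 1 w).symm) q _)
  have hSa2 : Sa * Sa = aeval T qa := hsq hα2
  have hSb2 : Sb * Sb = aeval T qb := hsq hβ2
  have hTQ : aeval T (Q.map (Int.castRingHom ℂ)) = 0 := by
    have hψQ' := aeval_hom_complexBetti_map_one_eq_zero hψQ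
    refine LinearMap.ext fun v ↦ ?_
    rw [LinearMap.zero_apply, ← sum_map_π_map_ι (fun _ : Fin (n + 1) => A) v, map_sum]
    refine Finset.sum_eq_zero fun c _ ↦ ?_
    have key := map_aeval_apply_of_semiconj (complexBetti.map (biproduct.π (fun _ : Fin (n + 1) => A) c).hom.hom.hom 1).hom
      (pullbackOne A ψ) T (fun w ↦ (map_biproductMap_map_π (fun _ : Fin (n + 1) => A) (fun _ => ψ) c 1 w).symm)
      (Q.map (Int.castRingHom ℂ)) (complexBetti.map (biproduct.ι (fun _ : Fin (n + 1) => A) c).hom.hom.hom 1 v)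
    rw [hψQ', LinearMap.zero_apply, map_zero] at key
    exact key.symm
  set s : Finset ℂ := (Q.map (Int.castRingHom ℂ)).roots.toFinset with hsdef
  obtain ⟨hnodal, hsne⟩ := nodal_roots_toFinset hQm hQirr
  have hTnodal : aeval T (Lagrange.nodal s id) = 0 := by rw [hsdef, hnodal, hTQ]
  have hmem_s : ∀ z ∈ s, (Q.map (Int.castRingHom ℂ)).IsRoot z := fun z hz ↦ by
    rw [hsdef] at hz
    exact (Polynomial.mem_roots (hQm.map _).ne_zero).1 (Multiset.mem_toFinset.1 hz)
  -- square roots of `a(z)`, `b(z)` at the places `z`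
  have hσex : ∀ z : ℂ, ∃ σ : ℂ, qa.eval z = σ * σ := fun z ↦ IsAlgClosed.exists_eq_mul_self _
  have hτex : ∀ z : ℂ, ∃ τ : ℂ, qb.eval z = τ * τ := fun z ↦ IsAlgClosed.exists_eq_mul_self _
  choose σ hσ using hσex
  choose τ hτ using hτex
  have hσ0 : ∀ z ∈ s, σ z ≠ 0 := fun z hz h0 ↦ hqa z (hmem_s z hz) (by rw [hσ z, h0, mul_zero])
  have hτ0 : ∀ z ∈ s, τ z ≠ 0 := fun z hz h0 ↦ hqb z (hmem_s z hz) (by rw [hτ z, h0, mul_zero])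
  -- the normalised pair `S = (⊕α)^* a(T)^{-1/2}`, `T' = (⊕β)^* b(T)^{-1/2}`
  obtain ⟨hS2, hRaRa'⟩ := sq_normaliser hsne hTnodal hSa2 hTSa (fun z hz ↦ hσ z) hσ0
  obtain ⟨hT2, hRbRb'⟩ := sq_normaliser hsne hTnodal hSb2 hTSb (fun z hz ↦ hτ z) hτ0
  set Ra : Module.End ℂ (complexBetti X.X 1) := aeval T (∑ w ∈ s, C ((σ w)⁻¹) * Lagrange.basis s id w) with hRadef
  set Ra' : Module.End ℂ (complexBetti X.X 1) := aeval T (∑ w ∈ s, C (σ w) * Lagrange.basis s id w) with hRa'def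
  set Rb : Module.End ℂ (complexBetti X.X 1) := aeval T (∑ w ∈ s, C ((τ w)⁻¹) * Lagrange.basis s id w) with hRbdef
  set Rb' : Module.End ℂ (complexBetti X.X 1) := aeval T (∑ w ∈ s, C (τ w) * Lagrange.basis s id w) with hRb'def
  have hRaSa : Ra * Sa = Sa * Ra := aeval_comm_of_comm T Sa hTSa _
  have hRaSb : Ra * Sb = Sb * Ra := aeval_comm_of_comm T Sb hTSb _
  have hRbSa : Rb * Sa = Sa * Rb := aeval_comm_of_comm T Sa hTSa _
  have hRbSb : Rb * Sb = Sb * Rb := aeval_comm_of_comm T Sb hTSb _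
  have hRbT : Rb * T = T * Rb := aeval_comm_of_comm T T rfl _
  have hRaT : Ra * T = T * Ra := aeval_comm_of_comm T T rfl _
  have hRa'T : Ra' * T = T * Ra' := aeval_comm_of_comm T T rfl _
  have hRb'T : Rb' * T = T * Rb' := aeval_comm_of_comm T T rfl _
  have hRaRb : Ra * Rb = Rb * Ra := aeval_comm_of_comm T Rb hRbT.symm _
  have hRaU : ∀ c d, Ra * U c d = U c d * Ra := fun c d ↦ aeval_comm_of_comm T (U c d) (hTU c d) _
  have hRbU : ∀ c d, Rb * U c d = U c d * Rb := fun c d ↦ aeval_comm_of_comm T (U c d) (hTU c d) _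
  have hRa_adj : ∀ v w : complexBetti X.X 1, polarizationPairingOne X.X D (X.dim - 1) (Ra v) w =
      polarizationPairingOne X.X D (X.dim - 1) v (Ra w) := fun v w ↦ pairing_aeval_symm _ T hT_symm.2 _ v w
  have hRb_adj : ∀ v w : complexBetti X.X 1, polarizationPairingOne X.X D (X.dim - 1) (Rb v) w =
      polarizationPairingOne X.X D (X.dim - 1) v (Rb w) := fun v w ↦ pairing_aeval_symm _ T hT_symm.2 _ v w
  have hCT : ∀ q : ℂ[X], aeval T q ∈ Algebra.adjoin ℂ (symmetricPullbackSpan X D : Set (Module.End ℂ (complexBetti X.X 1))) :=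
    fun q ↦ Algebra.adjoin_mono (Set.singleton_subset_iff.2 hT_symm) (Polynomial.aeval_mem_adjoin_singleton ℂ T)
  set S : Module.End ℂ (complexBetti X.X 1) := Sa * Ra with hSdef
  set T' : Module.End ℂ (complexBetti X.X 1) := Sb * Rb with hT'def
  have hcm : ∀ {L V W : Module.End ℂ (complexBetti X.X 1)}, L * V = V * L → L * W = W * L →
      L * (V * W) = V * W * L := fun h1 h2 ↦ by rw [← mul_assoc, h1, mul_assoc, h2, ← mul_assoc]
  have hST : S * T' = -(T' * S) := by
    have e1 : S * T' = Sa * Sb * (Ra * Rb) := by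
      rw [hSdef, hT'def, mul_assoc, ← mul_assoc Ra Sb, hRaSb, mul_assoc, ← mul_assoc Sa Sb]
    have e2 : T' * S = Sb * Sa * (Ra * Rb) := by
      rw [hSdef, hT'def, mul_assoc, ← mul_assoc Rb Sa, hRbSa, mul_assoc, ← mul_assoc Sb Sa, hRaRb]
    rw [e1, e2, hSanti, neg_mul]
  have hS_symm : ∀ v w : complexBetti X.X 1, polarizationPairingOne X.X D (X.dim - 1) (S v) w =
      polarizationPairingOne X.X D (X.dim - 1) v (S w) := by
    intro v w
    rw [hSdef, Module.End.mul_apply, hSa_full.2, hRa_adj, ← Module.End.mul_apply, hRaSa]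
  have hT'_symm : ∀ v w : complexBetti X.X 1, polarizationPairingOne X.X D (X.dim - 1) (T' v) w =
      polarizationPairingOne X.X D (X.dim - 1) v (T' w) := by
    intro v w
    rw [hT'def, Module.End.mul_apply, hSb_full.2, hRb_adj, ← Module.End.mul_apply, hRbSb]
  have hS_mem : S ∈ Algebra.adjoin ℂ (symmetricPullbackSpan X D : Set (Module.End ℂ (complexBetti X.X 1))) :=
    Subalgebra.mul_mem _ (Algebra.subset_adjoin hSa_full) (hCT _)
  have hT'_mem : T' ∈ Algebra.adjoin ℂ (symmetricPullbackSpan X D : Set (Module.End ℂ (complexBetti X.X 1))) :=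
    Subalgebra.mul_mem _ (Algebra.subset_adjoin hSb_full) (hCT _)
  have hS2' : S * S = (1:ℂ) • 1 := by rw [one_smul]; exact hS2
  have hT2' : T' * T' = (1:ℂ) • 1 := by rw [one_smul]; exact hT2
  have hTS : T * S = S * T := hcm hTSa hRaT.symm
  have hTT' : T * T' = T' * T := hcm hTSb hRbT.symm
  have hUS : ∀ c d, U c d * S = S * U c d := fun c d ↦ hcm (hSaU c d).symm (hRaU c d).symm
  have hUT' : ∀ c d, U c d * T' = T' * U c d := fun c d ↦ hcm (hSbU c d).symm (hRbU c d).symm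
  -- the `2 × 2` block of the normalised pair, inside `ℂ⟨S, T'⟩`
  obtain ⟨x', y', p', hyx', hsum', hadj', hx', hy', hST', hx'gen, hy'gen⟩ :=
    exists_matrixUnits_of_symmetric_anticommuting_pair (A := X) (h := D) one_ne_zero hS2' one_ne_zero hT2' hST
      hS_symm hT'_symm hS_mem hT'_mem
  have hcomm : ∀ L : Module.End ℂ (complexBetti X.X 1), L * S = S * L → L * T' = T' * L →
      ∀ g ∈ Algebra.adjoin ℂ ({S, T'} : Set (Module.End ℂ (complexBetti X.X 1))), L * g = g * L := by
    intro L hLa hLb g hg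
    have hL : L ∈ Subalgebra.centralizer ℂ ({S, T'} : Set (Module.End ℂ (complexBetti X.X 1))) := by
      rw [Subalgebra.mem_centralizer_iff]
      rintro g' (rfl | rfl)
      · exact hLa.symm
      · exact hLb.symm
    have hg' := Algebra.adjoin_le_centralizer_centralizer ℂ ({S, T'} : Set (Module.End ℂ (complexBetti X.X 1))) hg
    rw [Subalgebra.mem_centralizer_iff] at hg'
    exact hg' L hL
  have hUx' : ∀ c d k, U c d * x' k = x' k * U c d := fun c d k ↦ hcomm _ (hUS c d) (hUT' c d) _ (hx'gen k)
  have hUy' : ∀ c d k, U c d * y' k = y' k * U c d := fun c d k ↦ hcomm _ (hUS c d) (hUT' c d) _ (hy'gen k)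
  have hTx' : ∀ k, T * x' k = x' k * T := fun k ↦ hcomm _ hTS hTT' _ (hx'gen k)
  have hTy' : ∀ k, T * y' k = y' k * T := fun k ↦ hcomm _ hTS hTT' _ (hy'gen k)
  -- the combined Morita datum over `Fin (n+1) × Fin 2`
  let x : Fin (n + 1) × Fin 2 → Module.End ℂ (complexBetti X.X 1) := fun ic ↦ U ic.1 0 * x' ic.2
  let y : Fin (n + 1) × Fin 2 → Module.End ℂ (complexBetti X.X 1) := fun ic ↦ y' ic.2 * U 0 ic.1
  let p : Module.End ℂ (complexBetti X.X 1) := U 0 0 * p'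
  have hyx : ∀ ic jd, y ic * x jd = if ic = jd then p else 0 := by
    rintro ⟨i, c⟩ ⟨j, d⟩
    change y' c * U 0 i * (U j 0 * x' d) = if (i, c) = (j, d) then U 0 0 * p' else 0
    rw [mul_assoc, ← mul_assoc (U 0 i), hU]
    by_cases hij : i = j
    · subst hij
      rw [if_pos rfl, hUx', ← mul_assoc, hyx']
      by_cases hcd : c = d
      · subst hcd
        rw [if_pos rfl, if_pos rfl]
        exact (comm_idem_of_moritaData hyx' hsum' (fun k ↦ hUx' 0 0 k) (fun k ↦ hUy' 0 0 k)).symm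
      · rw [if_neg hcd, zero_mul, if_neg fun h ↦ hcd (Prod.mk.inj h).2]
    · rw [if_neg hij, zero_mul, mul_zero, if_neg fun h ↦ hij (Prod.mk.inj h).1]
  have hsumxy : ∑ ic, x ic * y ic = 1 := by
    rw [Fintype.sum_prod_type]
    change ∑ i, ∑ c, U i 0 * x' c * (y' c * U 0 i) = 1
    have e1 : ∀ i c, U i 0 * x' c * (y' c * U 0 i) = U i 0 * (x' c * y' c) * U 0 i := fun i c ↦ by
      rw [mul_assoc, mul_assoc, mul_assoc]
    simp_rw [e1, ← Finset.sum_mul, ← Finset.mul_sum, hsum', mul_one, hU, if_true]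
    exact hUsum
  have hadjxy : ∀ ic (v w : complexBetti X.X 1), polarizationPairingOne X.X D (X.dim - 1) (x ic v) w =
      polarizationPairingOne X.X D (X.dim - 1) v (y ic w) := by
    rintro ⟨i, c⟩ v w
    change polarizationPairingOne X.X D (X.dim - 1) ((U i 0 * x' c) v) w =
      polarizationPairingOne X.X D (X.dim - 1) v ((y' c * U 0 i) w)
    rw [Module.End.mul_apply, Module.End.mul_apply, hUadj, hadj']
  have hxmem : ∀ ic, x ic ∈ Algebra.adjoin ℂ (symmetricPullbackSpan X D : Set (Module.End ℂ (complexBetti X.X 1))) :=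
    fun ic ↦ Subalgebra.mul_mem _ (hUadjoin _ _) (hx' _)
  have hymem : ∀ ic, y ic ∈ Algebra.adjoin ℂ (symmetricPullbackSpan X D : Set (Module.End ℂ (complexBetti X.X 1))) :=
    fun ic ↦ Subalgebra.mul_mem _ (hy' _) (hUadjoin _ _)
  have hTx : ∀ ic, T * x ic = x ic * T := by
    rintro ⟨i, c⟩
    change T * (U i 0 * x' c) = U i 0 * x' c * T
    rw [← mul_assoc, hTU, mul_assoc, hTx', ← mul_assoc]
  have hTy : ∀ ic, T * y ic = y ic * T := by
    rintro ⟨i, c⟩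
    change T * (y' c * U 0 i) = y' c * U 0 i * T
    rw [← mul_assoc, hTy', mul_assoc, hTU, ← mul_assoc]
  -- the generators lie in `ℂ⟨T, x y⟩`
  have hW_unit : ∀ c d, U c d ∈ Submodule.span ℂ
      (Set.range fun st : (Fin (n + 1) × Fin 2) × (Fin (n + 1) × Fin 2) ↦ x st.1 * y st.2) := by
    intro c d
    have e1 : U c d = ∑ k, x (c, k) * y (d, k) := by
      change U c d = ∑ k, U c 0 * x' k * (y' k * U 0 d)
      have e2 : ∀ k, U c 0 * x' k * (y' k * U 0 d) = U c 0 * (x' k * y' k) * U 0 d := fun k ↦ by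
        rw [mul_assoc, mul_assoc, mul_assoc]
      simp_rw [e2, ← Finset.sum_mul, ← Finset.mul_sum, hsum', mul_one, hU, if_true]
    rw [e1]
    exact Submodule.sum_mem _ fun k _ ↦ Submodule.subset_span ⟨((c, k), (d, k)), rfl⟩
  have hW_pair : ∀ k l, x' k * y' l ∈ Submodule.span ℂ
      (Set.range fun st : (Fin (n + 1) × Fin 2) × (Fin (n + 1) × Fin 2) ↦ x st.1 * y st.2) := by
    intro k l
    have e1 : x' k * y' l = ∑ i, x (i, k) * y (i, l) := by
      change x' k * y' l = ∑ i, U i 0 * x' k * (y' l * U 0 i)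
      have e2 : ∀ i, U i 0 * x' k * (y' l * U 0 i) = x' k * y' l * (U i 0 * U 0 i) := fun i ↦ by
        rw [hUx', mul_assoc, mul_assoc, ← mul_assoc (U i 0), hUy', mul_assoc]
      simp_rw [e2, hU, if_true, ← Finset.mul_sum, hUsum, mul_one]
    rw [e1]
    exact Submodule.sum_mem _ fun i _ ↦ Submodule.subset_span ⟨((i, k), (i, l)), rfl⟩
  -- the generators lie in `ℂ⟨T, x y⟩`: `(⊕α)^* = S · (Σ_z σ_z P_z)`, `(⊕β)^* = T' · (Σ_z τ_z P_z)`
  have hSa_eq : Sa = S * Ra' := by rw [hSdef, mul_assoc, hRaRa', mul_one]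
  have hSb_eq : Sb = T' * Rb' := by rw [hT'def, mul_assoc, hRbRb', mul_one]
  have hgens : insert T (insert Sa (insert Sb (Set.range fun ab : Fin (n + 1) × Fin (n + 1) ↦ U ab.1 ab.2))) ⊆
      (Algebra.adjoin ℂ (insert T (Set.range fun st : (Fin (n + 1) × Fin 2) × (Fin (n + 1) × Fin 2) ↦
        x st.1 * y st.2)) : Set (Module.End ℂ (complexBetti X.X 1))) := by
    have hWR : Submodule.span ℂ (Set.range fun st : (Fin (n + 1) × Fin 2) × (Fin (n + 1) × Fin 2) ↦ x st.1 * y st.2) ≤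
        Subalgebra.toSubmodule (Algebra.adjoin ℂ (insert T (Set.range
          fun st : (Fin (n + 1) × Fin 2) × (Fin (n + 1) × Fin 2) ↦ x st.1 * y st.2))) :=
      Submodule.span_le.2 fun g hg ↦ Algebra.subset_adjoin (Set.mem_insert_of_mem _ hg)
    have hSW : ({S, T'} : Set (Module.End ℂ (complexBetti X.X 1))) ⊆ Submodule.span ℂ
        (Set.range fun st : (Fin (n + 1) × Fin 2) × (Fin (n + 1) × Fin 2) ↦ x st.1 * y st.2) :=
      hST'.trans (Submodule.span_le.2 (by rintro _ ⟨kl, rfl⟩; exact hW_pair kl.1 kl.2))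
    have hPT : ∀ q : ℂ[X], aeval T q ∈ Algebra.adjoin ℂ (insert T (Set.range
        fun st : (Fin (n + 1) × Fin 2) × (Fin (n + 1) × Fin 2) ↦ x st.1 * y st.2)) :=
      fun q ↦ Algebra.adjoin_mono (Set.singleton_subset_iff.2 (Set.mem_insert _ _))
        (Polynomial.aeval_mem_adjoin_singleton ℂ T)
    refine Set.insert_subset_iff.2 ⟨Algebra.subset_adjoin (Set.mem_insert _ _), Set.insert_subset_iff.2
      ⟨?_, Set.insert_subset_iff.2 ⟨?_, ?_⟩⟩⟩
    · rw [hSa_eq, hRa'def]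
      exact Subalgebra.mul_mem _ (hWR (hSW (Set.mem_insert _ _))) (hPT _)
    · rw [hSb_eq, hRb'def]
      exact Subalgebra.mul_mem _ (hWR (hSW (Set.mem_insert_of_mem _ (Set.mem_singleton _)))) (hPT _)
    · rintro _ ⟨ab, rfl⟩
      exact hWR (hW_unit ab.1 ab.2)
  exact weilClassesField_le_divisorClassesSpan_of_moritaData_of_symmetric hPm hPe hPirr hφ herX hhX hndX hyx hsumxy
    hadjxy hxmem hymem hT_symm hTx hTy hsne hTnodal (Algebra.adjoin_le hgens hF)

/-- **… and consists of HODGE classes** (`W_F ⊗ ℂ ≤ ℬᵐ ⊗ ℂ`). [cite: MoonenZarhin1998WeilClasses, §1 Criterion (2) and the Remark after it («type 1, 2 or 3 ⟹ n_σ = n_σ′»; chunk p0002 L1–L12, p0003 L46–L58)]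
[cite: vanGeemen1994HodgeAV, §2.4] -/
theorem weilClassesField_biproduct_le_hodgeClassSpan_of_mem_adjoin_quaternionOver_diagonal (hA : 0 < A.dim)
    (hh : h ∈ hodgeClassSpan A.dim A.X 1) (htop : lefschetzPow h (A.dim - 1) 2 h ≠ 0)
    (hnd : ∀ x : complexBetti A.X 1, (∀ y, polarizationPairingOne A.X h (A.dim - 1) x y = 0) → x = 0)
    (hψsym : ∀ v w : complexBetti A.X 1, polarizationPairingOne A.X h (A.dim - 1) (pullbackOne A ψ v) w =
      polarizationPairingOne A.X h (A.dim - 1) v (pullbackOne A ψ w))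
    (hQm : Q.Monic) (hQirr : Irreducible (Q.map (Int.castRingHom ℚ)))
    (hψQ : Polynomial.eval₂ (Int.castRingHom (CategoryTheory.End A)) (ψ : CategoryTheory.End A) Q = 0)
    (hα2 : pullbackOne A α * pullbackOne A α = aeval (pullbackOne A ψ) qa)
    (hqa : ∀ z : ℂ, (Q.map (Int.castRingHom ℂ)).IsRoot z → qa.eval z ≠ 0)
    (hβ2 : pullbackOne A β * pullbackOne A β = aeval (pullbackOne A ψ) qb)
    (hqb : ∀ z : ℂ, (Q.map (Int.castRingHom ℂ)).IsRoot z → qb.eval z ≠ 0)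
    (hanti : pullbackOne A α * pullbackOne A β = -(pullbackOne A β * pullbackOne A α))
    (hαsym : ∀ v w : complexBetti A.X 1, polarizationPairingOne A.X h (A.dim - 1) (pullbackOne A α v) w =
      polarizationPairingOne A.X h (A.dim - 1) v (pullbackOne A α w))
    (hβsym : ∀ v w : complexBetti A.X 1, polarizationPairingOne A.X h (A.dim - 1) (pullbackOne A β v) w =
      polarizationPairingOne A.X h (A.dim - 1) v (pullbackOne A β w))
    (hψα : pullbackOne A ψ * pullbackOne A α = pullbackOne A α * pullbackOne A ψ)
    (hψβ : pullbackOne A ψ * pullbackOne A β = pullbackOne A β * pullbackOne A ψ)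
    (hPm : P.Monic) (hPe : P.natDegree = e) (hPirr : Irreducible (P.map (Int.castRingHom ℚ)))
    (hφ : Polynomial.eval₂ (Int.castRingHom (CategoryTheory.End (⨁ (fun _ : Fin (n + 1) => A))))
      (φ : CategoryTheory.End (⨁ (fun _ : Fin (n + 1) => A))) P = 0)
    (her : e * (2 * m) = 2 * ((n + 1) * A.dim))
    (hF : pullbackOne (⨁ (fun _ : Fin (n + 1) => A)) φ ∈ Algebra.adjoin ℂ
      (insert (pullbackOne (⨁ (fun _ : Fin (n + 1) => A)) (biproduct.map fun _ : Fin (n + 1) => ψ))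
        (insert (pullbackOne (⨁ (fun _ : Fin (n + 1) => A)) (biproduct.map fun _ : Fin (n + 1) => α))
          (insert (pullbackOne (⨁ (fun _ : Fin (n + 1) => A)) (biproduct.map fun _ : Fin (n + 1) => β))
            (Set.range fun ab : Fin (n + 1) × Fin (n + 1) ↦ pullbackOne (⨁ (fun _ : Fin (n + 1) => A))
              (biproduct.π (fun _ : Fin (n + 1) => A) ab.1 ≫ biproduct.ι (fun _ : Fin (n + 1) => A) ab.2)))))) :
    weilClassesField (⨁ (fun _ : Fin (n + 1) => A)) φ P (2 * m) ≤
      hodgeClassSpan (⨁ (fun _ : Fin (n + 1) => A)).dim (⨁ (fun _ : Fin (n + 1) => A)).X m :=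
  (weilClassesField_biproduct_le_divisorClassesSpan_of_mem_adjoin_quaternionOver_diagonal hA hh htop hnd hψsym hQm
      hQirr hψQ hα2 hqa hβ2 hqb hanti hαsym hβsym hψα hψβ hPm hPe hPirr hφ her hF).trans
    (divisorClassesSpan_le_hodgeClassSpan_of_isSmoothProjective
      (AbelianVariety.isSmoothProjective_holds (A := (⨁ (fun _ : Fin (n + 1) => A)))) m)

/-- **… and is ALGEBRAIC**: `W_F ⊗ ℂ ≤ algebraicClasses` — THE WEIL CLASSES OF EVERY SUBFIELD OF `M_{n+1}(D)`, `D` A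
QUATERNION ALGEBRA OVER THE REAL-MULTIPLICATION FIELD `ℚ(ψ)` PRESENTED BY A ROSATI-SYMMETRIC ANTICOMMUTING PAIR, ON
`A^{n+1}` ARE ALGEBRAIC, by the Lefschetz theorem on `(1,1)`-classes (the tree's `lefschetzOneOne_rational_holds`).
[cite: MoonenZarhin1998WeilClasses, Introduction (chunk p0001 L10–L18) and §1 Criterion (2) (chunk p0003 L46–L90)]
[cite: VoisinHodgeI2002, Thm. 11.30] -/
theorem weilClassesField_biproduct_le_algebraicClasses_of_mem_adjoin_quaternionOver_diagonal (hA : 0 < A.dim)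
    (hh : h ∈ hodgeClassSpan A.dim A.X 1) (htop : lefschetzPow h (A.dim - 1) 2 h ≠ 0)
    (hnd : ∀ x : complexBetti A.X 1, (∀ y, polarizationPairingOne A.X h (A.dim - 1) x y = 0) → x = 0)
    (hψsym : ∀ v w : complexBetti A.X 1, polarizationPairingOne A.X h (A.dim - 1) (pullbackOne A ψ v) w =
      polarizationPairingOne A.X h (A.dim - 1) v (pullbackOne A ψ w))
    (hQm : Q.Monic) (hQirr : Irreducible (Q.map (Int.castRingHom ℚ)))
    (hψQ : Polynomial.eval₂ (Int.castRingHom (CategoryTheory.End A)) (ψ : CategoryTheory.End A) Q = 0)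
    (hα2 : pullbackOne A α * pullbackOne A α = aeval (pullbackOne A ψ) qa)
    (hqa : ∀ z : ℂ, (Q.map (Int.castRingHom ℂ)).IsRoot z → qa.eval z ≠ 0)
    (hβ2 : pullbackOne A β * pullbackOne A β = aeval (pullbackOne A ψ) qb)
    (hqb : ∀ z : ℂ, (Q.map (Int.castRingHom ℂ)).IsRoot z → qb.eval z ≠ 0)
    (hanti : pullbackOne A α * pullbackOne A β = -(pullbackOne A β * pullbackOne A α))
    (hαsym : ∀ v w : complexBetti A.X 1, polarizationPairingOne A.X h (A.dim - 1) (pullbackOne A α v) w =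
      polarizationPairingOne A.X h (A.dim - 1) v (pullbackOne A α w))
    (hβsym : ∀ v w : complexBetti A.X 1, polarizationPairingOne A.X h (A.dim - 1) (pullbackOne A β v) w =
      polarizationPairingOne A.X h (A.dim - 1) v (pullbackOne A β w))
    (hψα : pullbackOne A ψ * pullbackOne A α = pullbackOne A α * pullbackOne A ψ)
    (hψβ : pullbackOne A ψ * pullbackOne A β = pullbackOne A β * pullbackOne A ψ)
    (hPm : P.Monic) (hPe : P.natDegree = e) (hPirr : Irreducible (P.map (Int.castRingHom ℚ)))
    (hφ : Polynomial.eval₂ (Int.castRingHom (CategoryTheory.End (⨁ (fun _ : Fin (n + 1) => A))))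
      (φ : CategoryTheory.End (⨁ (fun _ : Fin (n + 1) => A))) P = 0)
    (her : e * (2 * m) = 2 * ((n + 1) * A.dim))
    (hF : pullbackOne (⨁ (fun _ : Fin (n + 1) => A)) φ ∈ Algebra.adjoin ℂ
      (insert (pullbackOne (⨁ (fun _ : Fin (n + 1) => A)) (biproduct.map fun _ : Fin (n + 1) => ψ))
        (insert (pullbackOne (⨁ (fun _ : Fin (n + 1) => A)) (biproduct.map fun _ : Fin (n + 1) => α))
          (insert (pullbackOne (⨁ (fun _ : Fin (n + 1) => A)) (biproduct.map fun _ : Fin (n + 1) => β))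
            (Set.range fun ab : Fin (n + 1) × Fin (n + 1) ↦ pullbackOne (⨁ (fun _ : Fin (n + 1) => A))
              (biproduct.π (fun _ : Fin (n + 1) => A) ab.1 ≫ biproduct.ι (fun _ : Fin (n + 1) => A) ab.2)))))) :
    weilClassesField (⨁ (fun _ : Fin (n + 1) => A)) φ P (2 * m) ≤ algebraicClasses (⨁ (fun _ : Fin (n + 1) => A)).X m :=
  (weilClassesField_biproduct_le_divisorClassesSpan_of_mem_adjoin_quaternionOver_diagonal hA hh htop hnd hψsym hQm
      hQirr hψQ hα2 hqa hβ2 hqb hanti hαsym hβsym hψα hψβ hPm hPe hPirr hφ her hF).trans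
    (AbelianVariety.divisorClassesSpan_le_algebraicClasses (⨁ (fun _ : Fin (n + 1) => A))
      (fun c hc hc' ↦ lefschetzOneOne_rational_holds
        (AbelianVariety.isSmoothProjective_holds (A := (⨁ (fun _ : Fin (n + 1) => A)))) c hc hc') m)

/-- Element form: every class of `W_F ⊗ ℂ` — in particular every rational Weil class of a subfield of `M_{n+1}(D)` on
`A^{n+1}` — is a `ℂ`-combination of algebraic classes. [cite: MoonenZarhin1998WeilClasses, Introduction (chunk p0001 L10–L18) and §1 Criterion (2) (chunk p0003 L46–L90)] -/
theorem mem_algebraicClasses_of_mem_weilClassesField_biproduct_of_mem_adjoin_quaternionOver_diagonal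
    (hA : 0 < A.dim)
    (hh : h ∈ hodgeClassSpan A.dim A.X 1) (htop : lefschetzPow h (A.dim - 1) 2 h ≠ 0)
    (hnd : ∀ x : complexBetti A.X 1, (∀ y, polarizationPairingOne A.X h (A.dim - 1) x y = 0) → x = 0)
    (hψsym : ∀ v w : complexBetti A.X 1, polarizationPairingOne A.X h (A.dim - 1) (pullbackOne A ψ v) w =
      polarizationPairingOne A.X h (A.dim - 1) v (pullbackOne A ψ w))
    (hQm : Q.Monic) (hQirr : Irreducible (Q.map (Int.castRingHom ℚ)))
    (hψQ : Polynomial.eval₂ (Int.castRingHom (CategoryTheory.End A)) (ψ : CategoryTheory.End A) Q = 0)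
    (hα2 : pullbackOne A α * pullbackOne A α = aeval (pullbackOne A ψ) qa)
    (hqa : ∀ z : ℂ, (Q.map (Int.castRingHom ℂ)).IsRoot z → qa.eval z ≠ 0)
    (hβ2 : pullbackOne A β * pullbackOne A β = aeval (pullbackOne A ψ) qb)
    (hqb : ∀ z : ℂ, (Q.map (Int.castRingHom ℂ)).IsRoot z → qb.eval z ≠ 0)
    (hanti : pullbackOne A α * pullbackOne A β = -(pullbackOne A β * pullbackOne A α))
    (hαsym : ∀ v w : complexBetti A.X 1, polarizationPairingOne A.X h (A.dim - 1) (pullbackOne A α v) w =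
      polarizationPairingOne A.X h (A.dim - 1) v (pullbackOne A α w))
    (hβsym : ∀ v w : complexBetti A.X 1, polarizationPairingOne A.X h (A.dim - 1) (pullbackOne A β v) w =
      polarizationPairingOne A.X h (A.dim - 1) v (pullbackOne A β w))
    (hψα : pullbackOne A ψ * pullbackOne A α = pullbackOne A α * pullbackOne A ψ)
    (hψβ : pullbackOne A ψ * pullbackOne A β = pullbackOne A β * pullbackOne A ψ)
    (hPm : P.Monic) (hPe : P.natDegree = e) (hPirr : Irreducible (P.map (Int.castRingHom ℚ)))
    (hφ : Polynomial.eval₂ (Int.castRingHom (CategoryTheory.End (⨁ (fun _ : Fin (n + 1) => A))))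
      (φ : CategoryTheory.End (⨁ (fun _ : Fin (n + 1) => A))) P = 0)
    (her : e * (2 * m) = 2 * ((n + 1) * A.dim))
    (hF : pullbackOne (⨁ (fun _ : Fin (n + 1) => A)) φ ∈ Algebra.adjoin ℂ
      (insert (pullbackOne (⨁ (fun _ : Fin (n + 1) => A)) (biproduct.map fun _ : Fin (n + 1) => ψ))
        (insert (pullbackOne (⨁ (fun _ : Fin (n + 1) => A)) (biproduct.map fun _ : Fin (n + 1) => α))
          (insert (pullbackOne (⨁ (fun _ : Fin (n + 1) => A)) (biproduct.map fun _ : Fin (n + 1) => β))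
            (Set.range fun ab : Fin (n + 1) × Fin (n + 1) ↦ pullbackOne (⨁ (fun _ : Fin (n + 1) => A))
              (biproduct.π (fun _ : Fin (n + 1) => A) ab.1 ≫ biproduct.ι (fun _ : Fin (n + 1) => A) ab.2))))))
    {c : complexBetti (⨁ (fun _ : Fin (n + 1) => A)).X (2 * m)}
    (hc : c ∈ weilClassesField (⨁ (fun _ : Fin (n + 1) => A)) φ P (2 * m)) :
    c ∈ algebraicClasses (⨁ (fun _ : Fin (n + 1) => A)).X m :=
  weilClassesField_biproduct_le_algebraicClasses_of_mem_adjoin_quaternionOver_diagonal hA hh htop hnd hψsym hQm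
      hQirr hψQ hα2 hqa hβ2 hqb hanti hαsym hβsym hψα hψβ hPm hPe hPirr hφ her hF hc

end QuaternionOverRealField

end Literature.AlgebraicGeometry.HodgeTheory

end
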